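import Summits.KontsevichZagierPeriods.KontsevichZagierPeriods.Theses.DimensionBudget

/-!
# `BudgetGlue` (stmt-KontsevichZagierPeriods-14385, route DimensionBudget) — proof

`BudgetGlue : BakerSectorDimOne → OneExtraDimension → BudgetThesis`: the route's target (Conjecture 1
with an explicit per-pair dimension budget `d`: equal-valued KZ-rational representations `r, r'` of
dimensions `n, m` satisfy `[r] − [r'] ∈ relations_≤d` for some `d`) is the conclusion of the route's two
layers by a case split on `max n m`:
* `max n m ≤ 1`: both dimensions are `≤ 1`, take `d := 1` and apply the Baker sector
  `BakerSectorDimOne` (whose conclusion is verbatim the inlined truncation at `1`);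
* otherwise `2 ≤ max n m`, take `d := max n m + 1` and apply the open core `OneExtraDimension`, whose
  conclusion `KZ.EquivalentLE (max n m + 1) r r'` unfolds by `rfl` (`KZ.equivalentLE_iff`,
  `KZ.relationsLE_def`) to the truncation `AddSubgroup.closure (moves ∩ formalRep_≤d)` inlined in
  `BudgetThesis`.
Pure logic over the route's own definitions, no new definitions; planner-proved glue (item docstring:
`budgetGlue_holds` in the route's Sketch.lean), landed by lead c10 of crux
stmt-KontsevichZagierPeriods-9129 (banking). Source: M. Kontsevich, D. Zagier, *Periods* (2001), §1.2
(Conjecture 1, Problem 2).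
-/

namespace Summit.KontsevichZagierPeriods.DimensionBudget

/-- **`BudgetGlue`** (route DimensionBudget, stmt-KontsevichZagierPeriods-14385):
`BakerSectorDimOne → OneExtraDimension → BudgetThesis` — by cases on `max n m ≤ 1`: budget `d := 1`
from `BakerSectorDimOne` (`n ≤ 1`, `m ≤ 1`), else budget `d := max n m + 1` from `OneExtraDimension`
(`2 ≤ max n m`; `KZ.EquivalentLE` is the inlined truncated membership by `rfl`). [folklore] -/
theorem budgetGlue_proof :
    Summit.KontsevichZagierPeriods.KontsevichZagierPeriods.Theses.DimensionBudget.BudgetGlue := by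
  intro hB hO n m r r' hr hr' hv
  by_cases h : max n m ≤ 1
  · exact ⟨1, hB (le_of_max_le_left h) (le_of_max_le_right h) r r' hr hr' hv⟩
  · exact ⟨max n m + 1, hO (Nat.lt_of_not_le h) r r' hr hr' hv⟩

end Summit.KontsevichZagierPeriods.DimensionBudget
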